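import Literature.NumberTheory.GelbartRogawski1991.UndoublingPlaceAssembly
import Literature.NumberTheory.GelbartRogawski1991.DoubledWeilRepresentationCMExplicit
import Literature.NumberTheory.GelbartRogawski1991.CMSplittingCharLocalMu
import HarnessLib

/-!
# The CM local splitting at a finite place depends on the Hecke character only through its local components there
# (locality of Kudla's `μ`-splitting in `μ_v`; [Liu2021, App. D §D.1 Step 2] «`ι_μ` … depends on `μ`», read at `μ_v`)

Topic `NumberTheory/GelbartRogawski1991`; namespace `Literature.NumberTheory.GelbartRogawski1991.GRConstruction` (and
`…UnitaryDualPair.LocalSplitting` for the datum-level lemmas).  THEOREMS ONLY (no definition, no named fact, no `sorry`).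

The tree's CM local splitting of `U(J)(F⁺_v)` attached to a Hecke character `χ` of the CM field `L`
(`localSplittingDatumCM … χ hχ` → `cmDatumAt` → `cmFinLocalFamily χ` → `undoubledSplittings χ 𝔪 (cmFinLocalFamily χ …)` →
`congrW`, the chain behind `finLocalSplittingsCM` / the χ-splitting `chiLocalSplittingsD` of the `hD3`/B01 consumers) is
built at the place `v` from the family `w ↦ (χ_w)⁻¹` of LOCAL COMPONENTS of `χ` at the places `w ∣ v` (data) and from
properties of `χ` (proofs).  Hence (kernel bookkeeping, no mathematics beyond proof irrelevance):

* `localSplittingDatumCM_congr` — two splitting characters `χ, χ'` with the same local components above `v` give THE SAME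
  local datum at `v`; `cmDatumAt_congr`, `localSplittingAt_cmFinLocalFamily_congr`,
  **`undoubledSplittings_cmFinLocalFamily_s_congr`** (the undoubled local section at `v` is the same), and `congrW_s_congr`
  (transport to the consumers' `W`-side Gram data commutes with taking the section at `v`);
* `forall_localComponent_eq_of_localMu_eq` — the local components above `v` agree as soon as Liu's Step-2 character
  `μ_v = localMu L χ v = ∏_{w ∣ v} χ_w` of `E_vˣ = (∏_{w ∣ v} L_w)ˣ` agrees (evaluate at units supported at one `w`), and
  conversely `localMu_congr`.

So the local Weil representation `ω(μ_v, ε_v)` of [Liu2021, App. D §D.1 Step 2] («we obtain … `ι_μ`», l. 5219), as the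
tree constructs it from a GLOBAL `μ`, depends only on `μ_v` — the input «equal sections for equal `μ_v`» of the «⇐»
direction of [Liu2021, Lem. D.1 (3)] (a4-liuD3 `stub_iso_of_params`).  Cell hodgecm-mathlib; HC_CM is not mentioned.

References: [Liu2021] Y. Liu, Camb. J. Math. 9 (2021) = arXiv:2102.11518, App. D §D.1 Step 2 (l. 5219); [Kudla1994]
S. Kudla, *Splitting metaplectic covers of dual reductive pairs*, Israel J. Math. 87 (1994), Thm. 3.1 (the splitting
determined by the character `χ_v`); [GelbartRogawski1991] §3.1 Prop. 3.1.1 p. 455.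
-/

set_option autoImplicit false

noncomputable section

open scoped Matrix Kronecker
open NumberField IsDedekindDomain MeasureTheory
open Literature.RepresentationTheory.HeisenbergGroup
open Literature.NumberTheory.Automorphic Literature.NumberTheory.Automorphic.UnitaryGroup
open Literature.NumberTheory.GaloisRepresentations Literature.RepresentationTheory.HarrisKudlaSweet1996

/-! ## §1 The local datum at `v` depends only on `(χ_w)_{w ∣ v}` -/

namespace Literature.NumberTheory.GelbartRogawski1991.UnitaryDualPair.LocalSplitting

section Datum

variable (L : Type) [Field L] [NumberField L] [IsCMField L]
  (v : HeightOneSpectrum (𝓞 (maximalRealSubfield L)))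
  [MeasurableSpace (v.adicCompletion (maximalRealSubfield L))] [BorelSpace (v.adicCompletion (maximalRealSubfield L))]
  (μ : Measure (v.adicCompletion (maximalRealSubfield L))) [μ.IsAddHaarMeasure]
  (n : ℕ) {T₀ : Matrix (Fin n) (Fin n) (maximalRealSubfield L)}

/-- (plumbing) the split datum as a function of the character family: equal families give equal data (the remaining
arguments are proofs about the family). [cite: Kudla1994, Thm. 3.1] -/
private theorem localSplittingDatumSplit_congr (hT₀ : T₀.IsSymm) (hT₀d : IsUnit T₀.det)
    {JD : Matrix (Fin (n + n)) (Fin (n + n)) L}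
    (hJD : JD = (gramD (maximalRealSubfield L) n T₀).map (algebraMap (maximalRealSubfield L) L))
    (w : PlacesOver L v) (hw : IsCMField.complexConj L • w.1 ≠ w.1)
    {χv χv' : ∀ w : PlacesOver L v, (w.1.adicCompletion L)ˣ →* ℂˣ} (h : χv = χv')
    (h₁ : IsTrivialNearOne (maximalRealSubfield L) L v w (χv w))
    (h₁' : IsTrivialNearOne (maximalRealSubfield L) L v w (χv' w)) :
    localSplittingDatumSplit (maximalRealSubfield L) L (IsCMField.complexConj L) (complexConj_imagUnit L)
        (imagUnit_ne_zero L) (imagUnit_mul_self L) v μ n hT₀ hT₀d hJD w hw χv h₁ =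
      localSplittingDatumSplit (maximalRealSubfield L) L (IsCMField.complexConj L) (complexConj_imagUnit L)
        (imagUnit_ne_zero L) (imagUnit_mul_self L) v μ n hT₀ hT₀d hJD w hw χv' h₁' := by
  subst h; rfl

/-- (plumbing) the non-split datum as a function of the character family. [cite: Kudla1994, Thm. 3.1] -/
private theorem localSplittingDatumNonsplit_congr (hT₀ : T₀.IsSymm) (hT₀d : IsUnit T₀.det)
    {JD : Matrix (Fin (n + n)) (Fin (n + n)) L}
    (hJD : JD = (gramD (maximalRealSubfield L) n T₀).map (algebraMap (maximalRealSubfield L) L))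
    (w : PlacesOver L v) (hw : IsCMField.complexConj L • w.1 = w.1)
    {χv χv' : ∀ w : PlacesOver L v, (w.1.adicCompletion L)ˣ →* ℂˣ} (h : χv = χv')
    (h₀ : IsEpsilonChar (maximalRealSubfield L) L v (imagUnitSq L) w (χv w))
    (h₀' : IsEpsilonChar (maximalRealSubfield L) L v (imagUnitSq L) w (χv' w))
    (h₁ : IsTrivialNearOne (maximalRealSubfield L) L v w (χv w))
    (h₁' : IsTrivialNearOne (maximalRealSubfield L) L v w (χv' w)) :
    localSplittingDatumNonsplit (maximalRealSubfield L) L (IsCMField.complexConj L) (complexConj_imagUnit L)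
        (imagUnit_ne_zero L) (imagUnit_mul_self L) v μ n hT₀ hT₀d hJD w hw χv h₀ h₁ =
      localSplittingDatumNonsplit (maximalRealSubfield L) L (IsCMField.complexConj L) (complexConj_imagUnit L)
        (imagUnit_ne_zero L) (imagUnit_mul_self L) v μ n hT₀ hT₀d hJD w hw χv' h₀' h₁' := by
  subst h; rfl

/-- **The CM local datum at `v` depends on `χ` only through `(χ_w)_{w ∣ v}`**: two splitting characters with the same
local components above `v` have THE SAME local splitting datum `localSplittingDatumCM` at `v` (same section `r`, same Kudla
function `β`, same splitting). [cite: Kudla1994, Thm. 3.1] [cite: Liu2021, App. D §D.1 Step 2 (l. 5219)] -/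
theorem localSplittingDatumCM_congr (hT₀ : T₀.IsSymm) (hT₀d : IsUnit T₀.det)
    {JD : Matrix (Fin (n + n)) (Fin (n + n)) L}
    (hJD : JD = (gramD (maximalRealSubfield L) n T₀).map (algebraMap (maximalRealSubfield L) L))
    (χ χ' : HeckeCharacter L) (hχ : IsSplittingChar L 1 χ) (hχ' : IsSplittingChar L 1 χ')
    (h : ∀ w : PlacesOver L v, χ.localComponent w.1 = χ'.localComponent w.1) :
    localSplittingDatumCM L v μ n hT₀ hT₀d hJD χ hχ = localSplittingDatumCM L v μ n hT₀ hT₀d hJD χ' hχ' := by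
  have hf : (fun w' : PlacesOver L v => (χ.localComponent w'.1)⁻¹) = fun w' : PlacesOver L v => (χ'.localComponent w'.1)⁻¹ :=
    funext fun w' => by rw [h w']
  unfold localSplittingDatumCM
  by_cases hs : ∃ w : PlacesOver L v, IsCMField.complexConj L • w.1 ≠ w.1
  · rw [dif_pos hs, dif_pos hs]
    exact localSplittingDatumSplit_congr L v μ n hT₀ hT₀d hJD _ _ hf _ _
  · rw [dif_neg hs, dif_neg hs]
    exact localSplittingDatumNonsplit_congr L v μ n hT₀ hT₀d hJD _ _ hf _ _ _ _

/-! ### `localMu` and the local components -/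

omit [IsCMField L] [MeasurableSpace (v.adicCompletion (maximalRealSubfield L))]
  [BorelSpace (v.adicCompletion (maximalRealSubfield L))] in
/-- `μ_v = ∏_{w ∣ v} χ_w` is the same for characters with the same local components above `v`.
[cite: Liu2021, App. D §D.1 Step 2 (l. 5219)] -/
theorem localMu_congr (χ χ' : HeckeCharacter L)
    (h : ∀ w : PlacesOver L v, χ.localComponent w.1 = χ'.localComponent w.1) : localMu L χ v = localMu L χ' v := by
  unfold localMu
  exact Finset.prod_congr rfl fun w _ => by rw [h w]

omit [IsCMField L] [MeasurableSpace (v.adicCompletion (maximalRealSubfield L))]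
  [BorelSpace (v.adicCompletion (maximalRealSubfield L))] in
/-- **conversely, `μ_v` determines every `χ_w`, `w ∣ v`** (evaluate the product character `∏_{w' ∣ v} χ_{w'}` of
`E_vˣ = (∏_{w' ∣ v} L_{w'})ˣ` at the units supported at `w`). [cite: Liu2021, App. D §D.1 Step 2 (l. 5219)] [cite: CasselsFrohlichANT1967, Ch. II §10] -/
theorem forall_localComponent_eq_of_localMu_eq (χ χ' : HeckeCharacter L) (h : localMu L χ v = localMu L χ' v)
    (w : PlacesOver L v) : χ.localComponent w.1 = χ'.localComponent w.1 := by
  classical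
  refine MonoidHom.ext fun u => ?_
  -- the unit of `E_v = ∏_{w' ∣ v} L_{w'}` equal to `u` at `w` and `1` elsewhere
  let f : ∀ w' : PlacesOver L v, (w'.1.adicCompletion L)ˣ := Pi.mulSingle w u
  let x : (LocalRing L v)ˣ := MulEquiv.piUnits.symm f
  have hx : ∀ w' : PlacesOver L v,
      Units.map (Pi.evalMonoidHom (fun w' : PlacesOver L v => w'.1.adicCompletion L) w') x = f w' := by
    intro w'
    ext
    rfl
  have hfw : f w = u := by
    show Pi.mulSingle (M := fun w' : PlacesOver L v => (w'.1.adicCompletion L)ˣ) w u w = u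
    exact Pi.mulSingle_eq_same (M := fun w' : PlacesOver L v => (w'.1.adicCompletion L)ˣ) w u
  have hfw' : ∀ w' : PlacesOver L v, w' ≠ w → f w' = 1 := fun w' hw' => by
    show Pi.mulSingle (M := fun w' : PlacesOver L v => (w'.1.adicCompletion L)ˣ) w u w' = 1
    exact Pi.mulSingle_eq_of_ne (M := fun w' : PlacesOver L v => (w'.1.adicCompletion L)ˣ) hw' u
  have key : ∀ ψ : HeckeCharacter L, localMu L ψ v x = ψ.localComponent w.1 u := by
    intro ψ
    unfold localMu
    rw [MonoidHom.finsetProd_apply, Finset.prod_eq_single w]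
    · rw [MonoidHom.coe_comp, Function.comp_apply, hx, hfw]
    · intro w' _ hw'
      rw [MonoidHom.coe_comp, Function.comp_apply, hx, hfw' w' hw', map_one]
    · intro hw
      exact absurd (Finset.mem_univ w) hw
  rw [← key χ, ← key χ', h]

end Datum

end Literature.NumberTheory.GelbartRogawski1991.UnitaryDualPair.LocalSplitting

/-! ## §2 Through the per-place package, the undoubling and the `W`-side transport -/

namespace Literature.NumberTheory.GelbartRogawski1991.GRConstruction

open UnitaryDualPair UnitaryDualPair.LocalSplitting

variable (L : Type) [Field L] [NumberField L] [IsCMField L]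
variable {N M n : ℕ} (e : Fin N × Fin M ≃ Fin n)
  (dV : Fin N → L) (hdV : ∀ i, IsCMField.complexConj L (dV i) = dV i) (hdV0 : ∀ i, dV i ≠ 0)
  (dW : Fin M → L) (hdW : ∀ i, IsCMField.complexConj L (dW i) = dW i) (hdW0 : ∀ i, dW i ≠ 0)
  (𝔪 : ∀ v, PlaceMeasure L v) (v : HeightOneSpectrum (𝓞 (Fp L)))

/-- **the CM datum of the package at `v` depends on `χ` only through `(χ_w)_{w ∣ v}`**. [cite: Kudla1994, Thm. 3.1] -/
theorem cmDatumAt_congr (χ χ' : HeckeCharacter L) (hχ : IsSplittingChar L 1 χ) (hχ' : IsSplittingChar L 1 χ')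
    (h : ∀ w : PlacesOver L v, χ.localComponent w.1 = χ'.localComponent w.1) :
    cmDatumAt L e dV hdV hdV0 dW hdW hdW0 χ hχ 𝔪 v = cmDatumAt L e dV hdV hdV0 dW hdW hdW0 χ' hχ' 𝔪 v := by
  letI := (𝔪 v).mS; haveI := (𝔪 v).isBorel; haveI := (𝔪 v).isHaar
  unfold cmDatumAt
  exact localSplittingDatumCM_congr L v (𝔪 v).μ n _ _ _ χ χ' hχ hχ' h

/-- **the local section of the CM package at `v` depends on `χ` only through `(χ_w)_{w ∣ v}`** (`s_v = (𝓓 v).localSplitting`).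
[cite: Kudla1994, Thm. 3.1] [cite: GelbartRogawski1991, §3.1 Prop. 3.1.1 p. 455] -/
theorem localSplittingAt_cmFinLocalFamily_congr (χ χ' : HeckeCharacter L) (hχ : IsSplittingChar L 1 χ)
    (hχ' : IsSplittingChar L 1 χ') (h : ∀ w : PlacesOver L v, χ.localComponent w.1 = χ'.localComponent w.1) :
    localSplittingAt L e dV hdV hdV0 dW hdW hdW0 χ 𝔪 (cmFinLocalFamily L e dV hdV hdV0 dW hdW hdW0 χ hχ 𝔪) v =
      localSplittingAt L e dV hdV hdV0 dW hdW hdW0 χ' 𝔪 (cmFinLocalFamily L e dV hdV hdV0 dW hdW hdW0 χ' hχ' 𝔪) v := by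
  unfold localSplittingAt cmFinLocalFamily
  dsimp only
  rw [cmDatumAt_congr L e dV hdV hdV0 dW hdW hdW0 𝔪 v χ χ' hχ hχ' h]

/-- **the UNDOUBLED local section at `v` (`undoubledSplittings χ 𝔪 (cmFinLocalFamily χ …)`, the finite-place datum of the
tree's χ-splittings `finLocalSplittingsCM` / `chiLocalSplittingsD`) depends on `χ` only through `(χ_w)_{w ∣ v}`**.
[cite: Kudla1994, Thm. 3.1] [cite: GelbartRogawski1991, §3.1 Prop. 3.1.1 p. 455 L1–3] [cite: Liu2021, App. D §D.1 Step 2 (l. 5219)] -/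
theorem undoubledSplittings_cmFinLocalFamily_s_congr (χ χ' : HeckeCharacter L) (hχ : IsSplittingChar L 1 χ)
    (hχ' : IsSplittingChar L 1 χ') (h : ∀ w : PlacesOver L v, χ.localComponent w.1 = χ'.localComponent w.1) :
    (undoubledSplittings L e dV hdV hdV0 dW hdW hdW0 χ 𝔪 (cmFinLocalFamily L e dV hdV hdV0 dW hdW hdW0 χ hχ 𝔪)).s v =
      (undoubledSplittings L e dV hdV hdV0 dW hdW hdW0 χ' 𝔪 (cmFinLocalFamily L e dV hdV hdV0 dW hdW hdW0 χ' hχ' 𝔪)).s v := by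
  have hs := localSplittingAt_cmFinLocalFamily_congr L e dV hdV hdV0 dW hdW hdW0 𝔪 v χ χ' hχ hχ' h
  unfold undoubledSplittings FinLocalSplittings.undouble finSplittings
  dsimp only
  congr 1

/-- the same from equality of Liu's Step-2 characters `μ_v`. [cite: Liu2021, App. D §D.1 Step 2 (l. 5219)] -/
theorem undoubledSplittings_cmFinLocalFamily_s_congr_of_localMu_eq (χ χ' : HeckeCharacter L) (hχ : IsSplittingChar L 1 χ)
    (hχ' : IsSplittingChar L 1 χ') (h : localMu L χ v = localMu L χ' v) :
    (undoubledSplittings L e dV hdV hdV0 dW hdW hdW0 χ 𝔪 (cmFinLocalFamily L e dV hdV hdV0 dW hdW hdW0 χ hχ 𝔪)).s v =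
      (undoubledSplittings L e dV hdV hdV0 dW hdW hdW0 χ' 𝔪 (cmFinLocalFamily L e dV hdV hdV0 dW hdW hdW0 χ' hχ' 𝔪)).s v :=
  undoubledSplittings_cmFinLocalFamily_s_congr L e dV hdV hdV0 dW hdW hdW0 𝔪 v χ χ' hχ hχ'
    (forall_localComponent_eq_of_localMu_eq L v χ χ' h)

/-- **taking the section at `v` commutes with the transport `congrW` to the consumers' `W`-side Gram data**: two families
with the same section at `v` still have the same section at `v` after `congrW`. [cite: GelbartRogawski1991, §3.1 Prop. 3.1.1 p. 455 L1–3] -/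
theorem congrW_s_congr {TW' : Matrix (Fin M) (Fin M) (Fp L)} {JW' : Matrix (Fin M) (Fin M) L}
    (hT : realDiagonal L dW hdW = TW') (hJ : Matrix.diagonal dW = JW')
    (𝓢 𝓢' : FinLocalSplittings (Fp L) L (IsCMField.complexConj L) n (complexConj_imagUnit L) (imagUnit_ne_zero L)
      (imagUnit_mul_self L) (gramR L e dV hdV dW hdW) (gramR_isSymm L e dV hdV dW hdW)
      (J := Matrix.reindex e e (Matrix.diagonal dV ⊗ₖ Matrix.diagonal dW))
      (reindex_kronecker_eq_gram_map (Fp L) L e (realDiagonal_map L dV hdV).symm (realDiagonal_map L dW hdW).symm))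
    (hW' : TW'.IsSymm) (hJW' : JW' = TW'.map (algebraMap (Fp L) L)) (h : 𝓢.s v = 𝓢'.s v) :
    (congrW L e dV hdV dW hdW hT hJ 𝓢 hW' hJW').s v = (congrW L e dV hdV dW hdW hT hJ 𝓢' hW' hJW').s v := by
  subst hT hJ
  exact h

end Literature.NumberTheory.GelbartRogawski1991.GRConstruction

end
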